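/-
Copyright (c) 2026. All rights reserved.
Released under Apache 2.0 license as described in the file LICENSE.
Authors: HodgeCM publication cell (pub-hodgecm), GR lane, seat GR-2 (`pub-hodgecm-own-hyp34`).
-/
import Literature.NumberTheory.GelbartRogawski1991.Prop311PrintedDualPairLine
import Literature.NumberTheory.Weil1964.AdelicMetaplecticTransport
import HarnessLib

-- build-lane note (ops-buildfix G11b-3 recipe): dependent telescopes of the dual-pair datum; elaborate sequentially.
set_option Elab.async false

/-!
# [GelbartRogawski1991, Prop. 3.1.1] AS PRINTED: the `Mp` leg reduced to the STANDARD symplectic form and a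
# Darboux frame (`Mp_ψ(𝐀ⁿ × 𝐀ⁿ, x·y′ − x′·y)ᶜᵒⁿᵗ → Mp_𝐀(W)`)

Topic `NumberTheory/GelbartRogawski1991`; namespace `Literature.NumberTheory.GelbartRogawski1991.Prop311`.
Definitions and proved lemmas only; nothing of [GelbartRogawski1991] is asserted; `Prop311AsPrinted` is untouched.

`Prop311PrintedDualPairLine.printed_conclusion_of_dualPairLine` derives clauses (1)+(2) of
[GelbartRogawski1991, Prop. 3.1.1] VERBATIM (as rendered in `Prop311AsPrinted`) from the tree's record
`SplittingDatum.CompatibleSplitting` at the dual-pair line datum, given ONE remaining input — a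
continuous homomorphism `φ : Mp_ψ(𝕎_𝐀)ᶜᵒⁿᵗ →* Mp_𝐀(W)` from the smooth metaplectic group of the Gram matrix
`𝕋 = adelicGram e T 1` (`T = diag(-2 d fᵢ)`) to the printed metaplectic group, lying over `(frameSp b)⁻¹`.
The smooth model is NATURAL in the Gram matrix (`Weil1964.AdelicMetaplecticTransport`: the relabelling
`Λ_C : (x, y) ↦ (x, C y)`, `adelicMpContRelabel C hC : Mp_ψ(W_{T′})ᶜᵒⁿᵗ ≃* Mp_ψ(W_T)ᶜᵒⁿᵗ` for `T C = T′`, SAME operators,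
projection conjugated by `Λ_C`).  This file uses it with `T := 1`, `C := 𝕋` to restate the remaining input over the
STANDARD form `x ⬝ᵥ y′ − x′ ⬝ᵥ y` of `𝐀ⁿ × 𝐀ⁿ` — the form of the tree's adelic Darboux coordinates
(`Prop311AdelicCoordinates.exists_adelicDarboux`, the coordinates of the `L²`-models of `ρ_ψ`):

* §1 `legGL` (`C = 𝕋 ∈ GL_n(𝐀)`, `1 · C = 𝕋`), **`darbouxFrame b f e : 𝐀ⁿ × 𝐀ⁿ ≃ₗ[𝐀] W_𝐀`** `:= (adelicFrame b)⁻¹ ∘ Λ_C⁻¹`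
  and **`adelicTraceForm_darbouxFrame`**: `φ_𝐀(darbouxFrame c, darbouxFrame c′) = c.1 ⬝ᵥ c′.2 − c′.1 ⬝ᵥ c.2` — it IS
  an adelic Darboux frame in the normalisation of `exists_adelicDarboux`;
* §2 **`mpLeg φ₁ := φ₁ ∘ adelicMpContRelabel C`**: a homomorphism `φ₁ : Mp_ψ(𝐀ⁿ × 𝐀ⁿ, std)ᶜᵒⁿᵗ →* Mp_𝐀(W)` over the
  Darboux frame (`π(φ₁ m₁) ∘ darbouxFrame = darbouxFrame ∘ π(m₁)`, pointwise) yields the leg over `(frameSp b)⁻¹`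
  (`mpLeg_proj`), continuous if `φ₁` is (`continuous_mpLeg`);
* §3 **`printed_conclusion_of_darbouxLeg`** (any quadratic `E/F`, premise: the record at the dual-pair line datum):
  clauses (1)+(2) of Prop. 3.1.1 as printed, from `φ₁` (plus the printed data `ρ, i, hi, hi!`, `φ` non-degenerate, and
  an orthogonal frame); the CM specialisation (premise discharged by `GRConstruction.gru_shape`) is
  `Prop311PrintedCMLeg.printed_conclusion_CM_of_darbouxLeg`.

## References
* [GelbartRogawski1991] S. Gelbart, J. Rogawski, Invent. Math. 105 (1991) 445–472, §3.1 p. 454 L17–42, Prop. 3.1.1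
  p. 455 L1–2.
* [MoeglinVignerasWaldspurger1987] C. Mœglin, M.-F. Vignéras, J.-L. Waldspurger, LNM 1291, Chap. 2 I.4, II.1.
* [Weil1964] A. Weil, Acta Math. 111 (1964), Chap. I n° 3–5.
-/

set_option autoImplicit false

noncomputable section

open NumberField
open scoped TensorProduct Matrix Kronecker
open Literature.NumberTheory.Automorphic
open Literature.NumberTheory.Automorphic.UnitaryGroup
open Literature.RepresentationTheory.HeisenbergGroup
open Literature.NumberTheory.Weil1964

namespace Literature.NumberTheory.GelbartRogawski1991

namespace Prop311

open UnitaryDualPair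

variable (F : Type) [Field F] [NumberField F]
variable (E : Type) [Field E] [NumberField E] [Algebra F E] [Algebra.IsQuadraticExtension F E]
variable (σ : E ≃ₐ[F] E) {δ : E} (hσδ : σ δ = -δ) (hδ : δ ≠ 0) {d : F} (hd : δ * δ = algebraMap F E d)
variable (V : Type) [AddCommGroup V] [Module F V] [Module E V] [IsScalarTower F E V]
variable {n : ℕ} (b : Module.Basis (Fin n) E V)
variable (Φ : V →ₗ[F] V →ₗ[F] E) (f : Fin n → F)
variable (e : Fin n × Fin 1 ≃ Fin n) (he : ∀ k : Fin n, (e.symm k).1 = k)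
variable (hT : IsUnit (symplecticGram F d f).det)

/-! ## §1. The Darboux frame of the standard form attached to an orthogonal frame -/

section Darboux

/-- the canonical relabelling `Fin n × Fin 1 ≃ Fin n` of the dual pair with line second factor (a valid `e`, see
`lineIndex_symm_fst` for its hypothesis `he`). [cite: GelbartRogawski1991, §3.2 p. 457] -/
def lineIndex (n : ℕ) : Fin n × Fin 1 ≃ Fin n :=
  Equiv.prodUnique (Fin n) (Fin 1)

/-- `he` for `lineIndex`: `((lineIndex n).symm k).1 = k`. [cite: GelbartRogawski1991, §3.2 p. 457] -/
@[simp] theorem lineIndex_symm_fst (k : Fin n) : ((lineIndex n).symm k).1 = k :=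
  rfl

omit [NumberField F] [NumberField E] [Algebra.IsQuadraticExtension F E] [IsScalarTower F E V] in
/-- in the printed setting the frame parameters are non-zero: **`φ` non-degenerate ⇒ `fᵢ ≠ 0`** for a
`Φ`-orthogonal frame with `Φ(bᵢ, bᵢ) = fᵢ δ` (the Gram matrix `δ · diag f` is invertible, `isUnit_det_gramMatrix`).
[cite: GelbartRogawski1991, §3.1 p. 454 L17, L37–42] -/
theorem frame_ne_zero_of_nondegenerate (hΦ₁ : ∀ (a : E) (x y : V), Φ (a • x) y = a * Φ x y)
    (hΦ₂ : ∀ (a : E) (x y : V), Φ x (a • y) = Φ x y * σ a) (hb : ∀ i j, i ≠ j → Φ (b i) (b j) = 0)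
    (hf : ∀ i, Φ (b i) (b i) = algebraMap F E (f i) * δ) (hφ : (traceForm F E V Φ).Nondegenerate)
    (i : Fin n) : f i ≠ 0 := by
  intro h0
  have hdet := isUnit_det_gramMatrix F E σ V b Φ hΦ₁ hΦ₂ hφ
  rw [gramMatrix_eq_of_orthogonal F E V b Φ f hb hf, Matrix.diagonal_map (map_zero _), Matrix.det_smul,
    Matrix.det_diagonal, isUnit_iff_ne_zero] at hdet
  exact hdet (mul_eq_zero_of_right _
    (Finset.prod_eq_zero (Finset.mem_univ i) (by rw [h0, map_zero])))

/-- **the relabelling matrix `C := 𝕋 = adelicGram e T 1 ∈ GL_n(𝐀)`** (`relabelGL` for `T := 1`, `T′ := 𝕋`).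
[cite: GelbartRogawski1991, §3.1 p. 454 L17–22] -/
def legGL : GL (Fin n) (AdeleRing (𝓞 F) F) :=
  relabelGL F (Fin n) (T := (1 : Matrix (Fin n) (Fin n) (AdeleRing (𝓞 F) F)))
    (T' := UnitaryDualPair.adelicGram F e (symplecticGram F d f) (1 : Matrix (Fin 1) (Fin 1) F))
    (by rw [Matrix.det_one]; exact isUnit_one)
    (UnitaryDualPair.isUnit_det_adelicGram F e hT (by rw [Matrix.det_one]; exact isUnit_one))

/-- `1 · C = 𝕋` (the hypothesis `hC` of the relabelling). [cite: GelbartRogawski1991, §3.1 p. 454 L17–22] -/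
theorem one_mul_legGL :
    (1 : Matrix (Fin n) (Fin n) (AdeleRing (𝓞 F) F)) * (legGL F f e hT : Matrix (Fin n) (Fin n) (AdeleRing (𝓞 F) F)) =
      UnitaryDualPair.adelicGram F e (symplecticGram F d f) (1 : Matrix (Fin 1) (Fin 1) F) :=
  mul_relabelGL F (Fin n) _ _

/-- **the Darboux frame `darbouxFrame b f e := (adelicFrame b)⁻¹ ∘ Λ_C⁻¹ : 𝐀ⁿ × 𝐀ⁿ ≃ₗ[𝐀] W_𝐀`** (`Λ_C (x, y) = (x, 𝕋 y)`).
[cite: GelbartRogawski1991, §3.1 p. 454 L17–22, L40–42] -/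
def darbouxFrame :
    ((Fin n → AdeleRing (𝓞 F) F) × (Fin n → AdeleRing (𝓞 F) F)) ≃ₗ[AdeleRing (𝓞 F) F] AdelicSpace F V :=
  (relabelVec F (Fin n) (legGL F f e hT)).symm.trans (adelicFrame F E σ hσδ hδ hd V b).symm

/-- `adelicFrame b (darbouxFrame c) = Λ_C⁻¹ c`. [cite: GelbartRogawski1991, §3.1 p. 454 L40–42] -/
theorem adelicFrame_darbouxFrame (c : (Fin n → AdeleRing (𝓞 F) F) × (Fin n → AdeleRing (𝓞 F) F)) :
    adelicFrame F E σ hσδ hδ hd V b (darbouxFrame F E σ hσδ hδ hd V b f e hT c) =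
      (relabelVec F (Fin n) (legGL F f e hT)).symm c := by
  rw [darbouxFrame, LinearEquiv.trans_apply, LinearEquiv.apply_symm_apply]

/-- `darbouxFrame (Λ_C p) = (adelicFrame b)⁻¹ p`. [cite: GelbartRogawski1991, §3.1 p. 454 L40–42] -/
theorem darbouxFrame_relabelVec (p : (Fin n → AdeleRing (𝓞 F) F) × (Fin n → AdeleRing (𝓞 F) F)) :
    darbouxFrame F E σ hσδ hδ hd V b f e hT (relabelVec F (Fin n) (legGL F f e hT) p) =
      (adelicFrame F E σ hσδ hδ hd V b).symm p := by
  rw [darbouxFrame, LinearEquiv.trans_apply, LinearEquiv.symm_apply_apply]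

include he in
/-- **`darbouxFrame` is an adelic Darboux frame**: `φ_𝐀(darbouxFrame c, darbouxFrame c′) = c.1 ⬝ᵥ c′.2 − c′.1 ⬝ᵥ c.2` — the
normalisation of `Prop311AdelicCoordinates.exists_adelicDarboux` (`φ = Tr_{E/F} Φ`; `Φ`-orthogonal frame `b` with
`Φ(bᵢ, bᵢ) = fᵢ δ`). [cite: GelbartRogawski1991, §3.1 p. 454 L17–22, L40–42] -/
theorem adelicTraceForm_darbouxFrame (hΦ₁ : ∀ (a : E) (x y : V), Φ (a • x) y = a * Φ x y)
    (hΦ₂ : ∀ (a : E) (x y : V), Φ x (a • y) = Φ x y * σ a) (hb : ∀ i j, i ≠ j → Φ (b i) (b j) = 0)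
    (hf : ∀ i, Φ (b i) (b i) = algebraMap F E (f i) * δ)
    (c c' : (Fin n → AdeleRing (𝓞 F) F) × (Fin n → AdeleRing (𝓞 F) F)) :
    adelicTraceForm F E V Φ (darbouxFrame F E σ hσδ hδ hd V b f e hT c) (darbouxFrame F E σ hσδ hδ hd V b f e hT c') =
      c.1 ⬝ᵥ c'.2 - c'.1 ⬝ᵥ c.2 := by
  rw [adelicTraceForm_eq_alt_polar F E σ hσδ hδ hd V b Φ f hΦ₁ hΦ₂ hb hf, adelicFrame_darbouxFrame,
    adelicFrame_darbouxFrame]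
  simp only [alt_apply, polar_apply, relabelVec_symm_apply, Matrix.toLinearMap₂'_apply', Matrix.mulVec_mulVec]
  rw [← adelicGram_line F f e he, mul_inv_eq_of_relabel F (Fin n) (legGL F f e hT) (one_mul_legGL F f e hT),
    Matrix.one_mulVec, Matrix.one_mulVec]

end Darboux

/-! ## §2. The `Mp` leg over `(frameSp b)⁻¹` from a leg over the Darboux frame -/

section Leg

variable {S : Type} [NormedAddCommGroup S] [InnerProductSpace ℂ S]
variable (ρ : Representation ℂ (AdelicHeisenberg F E V Φ) S)

omit [NumberField E] [Algebra.IsQuadraticExtension F E] [Module E V] [IsScalarTower F E V] in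
/-- **the `Mp` leg `mpLeg φ₁ := φ₁ ∘ relabel_C : Mp_ψ(𝕎_𝐀)ᶜᵒⁿᵗ →* Mp_𝐀(W)`** (Gram matrix `𝕋`) obtained from a leg
`φ₁ : Mp_ψ(𝐀ⁿ × 𝐀ⁿ, std)ᶜᵒⁿᵗ →* Mp_𝐀(W)` over the standard form. [cite: GelbartRogawski1991, §3.1 p. 454 L17–30] -/
def mpLeg (φ₁ : adelicMpCont F (Fin n) (1 : Matrix (Fin n) (Fin n) (AdeleRing (𝓞 F) F)) →* adelicMp F E V Φ ρ) :
    adelicMpCont F (Fin n) (UnitaryDualPair.adelicGram F e (symplecticGram F d f) (1 : Matrix (Fin 1) (Fin 1) F)) →*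
      adelicMp F E V Φ ρ :=
  φ₁.comp (adelicMpContRelabel F (Fin n) (legGL F f e hT) (one_mul_legGL F f e hT)).toMonoidHom

omit [NumberField E] [Algebra.IsQuadraticExtension F E] [Module E V] [IsScalarTower F E V] in
/-- formula. [cite: GelbartRogawski1991, §3.1 p. 454 L17–30] -/
theorem mpLeg_apply (φ₁ : adelicMpCont F (Fin n) (1 : Matrix (Fin n) (Fin n) (AdeleRing (𝓞 F) F)) →* adelicMp F E V Φ ρ)
    (m : adelicMpCont F (Fin n) (UnitaryDualPair.adelicGram F e (symplecticGram F d f) (1 : Matrix (Fin 1) (Fin 1) F))) :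
    mpLeg F E V Φ f e hT ρ φ₁ m =
      φ₁ (adelicMpContRelabel F (Fin n) (legGL F f e hT) (one_mul_legGL F f e hT) m) :=
  rfl

omit [NumberField E] [Algebra.IsQuadraticExtension F E] [Module E V] [IsScalarTower F E V] in
/-- the leg is continuous when `φ₁` is (the relabelling of record is a homeomorphic isomorphism).
[cite: Weil1964, Chap. III n° 39 p. 189] -/
theorem continuous_mpLeg
    (φ₁ : adelicMpCont F (Fin n) (1 : Matrix (Fin n) (Fin n) (AdeleRing (𝓞 F) F)) →* adelicMp F E V Φ ρ)
    (hφ₁ : Continuous φ₁) : Continuous (mpLeg F E V Φ f e hT ρ φ₁) :=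
  hφ₁.comp (continuous_adelicMpContRelabel F (Fin n) _ _)

/-- **the leg lies over `(frameSp b)⁻¹`** when `φ₁` lies over the Darboux frame: `frameConj b (π(mpLeg φ₁ m)) = π(m)`.
[cite: GelbartRogawski1991, §3.1 p. 454 L17–30, L40–42] -/
theorem mpLeg_proj
    (φ₁ : adelicMpCont F (Fin n) (1 : Matrix (Fin n) (Fin n) (AdeleRing (𝓞 F) F)) →* adelicMp F E V Φ ρ)
    (hproj₁ : ∀ (m₁ : adelicMpCont F (Fin n) (1 : Matrix (Fin n) (Fin n) (AdeleRing (𝓞 F) F)))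
        (c : (Fin n → AdeleRing (𝓞 F) F) × (Fin n → AdeleRing (𝓞 F) F)),
      ((proj F E V Φ ρ (φ₁ m₁) : adelicSp F E V Φ) : AdelicSpace F V ≃ₗ[AdeleRing (𝓞 F) F] AdelicSpace F V)
          (darbouxFrame F E σ hσδ hδ hd V b f e hT c) =
        darbouxFrame F E σ hσδ hδ hd V b f e hT
          (((adelicMpCont.proj F (Fin n) (1 : Matrix (Fin n) (Fin n) (AdeleRing (𝓞 F) F)) m₁ :
              symplecticGroup (polar (adelicForm F (Fin n) (1 : Matrix (Fin n) (Fin n) (AdeleRing (𝓞 F) F))))) :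
            ((Fin n → AdeleRing (𝓞 F) F) × (Fin n → AdeleRing (𝓞 F) F)) ≃ₗ[AdeleRing (𝓞 F) F]
              ((Fin n → AdeleRing (𝓞 F) F) × (Fin n → AdeleRing (𝓞 F) F))) c))
    (m : adelicMpCont F (Fin n) (UnitaryDualPair.adelicGram F e (symplecticGram F d f) (1 : Matrix (Fin 1) (Fin 1) F))) :
    frameConj F E σ hσδ hδ hd V b ((proj F E V Φ ρ (mpLeg F E V Φ f e hT ρ φ₁ m) : adelicSp F E V Φ) :
        AdelicSpace F V ≃ₗ[AdeleRing (𝓞 F) F] AdelicSpace F V) =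
      ((adelicMpCont.proj F (Fin n)
          (UnitaryDualPair.adelicGram F e (symplecticGram F d f) (1 : Matrix (Fin 1) (Fin 1) F)) m :
          symplecticGroup (polar (adelicForm F (Fin n)
            (UnitaryDualPair.adelicGram F e (symplecticGram F d f) (1 : Matrix (Fin 1) (Fin 1) F))))) :
        ((Fin n → AdeleRing (𝓞 F) F) × (Fin n → AdeleRing (𝓞 F) F)) ≃ₗ[AdeleRing (𝓞 F) F]
          ((Fin n → AdeleRing (𝓞 F) F) × (Fin n → AdeleRing (𝓞 F) F))) := by
  refine LinearEquiv.ext fun p => ?_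
  -- no `rw` on this goal: both sides are stuck projections against which pattern unification is costly; we chain
  -- fully instantiated equations instead (`proj_relabel`, `coe_symplecticGroupCongr_apply`, `mpLeg_apply` are `rfl`).
  have hp : adelicFrame F E σ hσδ hδ hd V b
      (darbouxFrame F E σ hσδ hδ hd V b f e hT (relabelVec F (Fin n) (legGL F f e hT) p)) = p := by
    rw [darbouxFrame_relabelVec, LinearEquiv.apply_symm_apply]
  have h3 : ((adelicMpCont.proj F (Fin n) (1 : Matrix (Fin n) (Fin n) (AdeleRing (𝓞 F) F))
        (adelicMpContRelabel F (Fin n) (legGL F f e hT) (one_mul_legGL F f e hT) m) :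
          symplecticGroup (polar (adelicForm F (Fin n) (1 : Matrix (Fin n) (Fin n) (AdeleRing (𝓞 F) F))))) :
        ((Fin n → AdeleRing (𝓞 F) F) × (Fin n → AdeleRing (𝓞 F) F)) ≃ₗ[AdeleRing (𝓞 F) F]
          ((Fin n → AdeleRing (𝓞 F) F) × (Fin n → AdeleRing (𝓞 F) F)))
        (relabelVec F (Fin n) (legGL F f e hT) p) =
      relabelVec F (Fin n) (legGL F f e hT)
        (((adelicMpCont.proj F (Fin n)
            (UnitaryDualPair.adelicGram F e (symplecticGram F d f) (1 : Matrix (Fin 1) (Fin 1) F)) m :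
            symplecticGroup (polar (adelicForm F (Fin n)
              (UnitaryDualPair.adelicGram F e (symplecticGram F d f) (1 : Matrix (Fin 1) (Fin 1) F))))) :
          ((Fin n → AdeleRing (𝓞 F) F) × (Fin n → AdeleRing (𝓞 F) F)) ≃ₗ[AdeleRing (𝓞 F) F]
            ((Fin n → AdeleRing (𝓞 F) F) × (Fin n → AdeleRing (𝓞 F) F))) p) :=
    congrArg
      (fun q => relabelVec F (Fin n) (legGL F f e hT)
        (((adelicMpCont.proj F (Fin n)
            (UnitaryDualPair.adelicGram F e (symplecticGram F d f) (1 : Matrix (Fin 1) (Fin 1) F)) m :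
            symplecticGroup (polar (adelicForm F (Fin n)
              (UnitaryDualPair.adelicGram F e (symplecticGram F d f) (1 : Matrix (Fin 1) (Fin 1) F))))) :
          ((Fin n → AdeleRing (𝓞 F) F) × (Fin n → AdeleRing (𝓞 F) F)) ≃ₗ[AdeleRing (𝓞 F) F]
            ((Fin n → AdeleRing (𝓞 F) F) × (Fin n → AdeleRing (𝓞 F) F))) q))
      ((relabelVec F (Fin n) (legGL F f e hT)).symm_apply_apply p)
  calc frameConj F E σ hσδ hδ hd V b ((proj F E V Φ ρ (mpLeg F E V Φ f e hT ρ φ₁ m) : adelicSp F E V Φ) :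
            AdelicSpace F V ≃ₗ[AdeleRing (𝓞 F) F] AdelicSpace F V) p
      = frameConj F E σ hσδ hδ hd V b ((proj F E V Φ ρ (mpLeg F E V Φ f e hT ρ φ₁ m) : adelicSp F E V Φ) :
            AdelicSpace F V ≃ₗ[AdeleRing (𝓞 F) F] AdelicSpace F V)
          (adelicFrame F E σ hσδ hδ hd V b
            (darbouxFrame F E σ hσδ hδ hd V b f e hT (relabelVec F (Fin n) (legGL F f e hT) p))) :=
        (congrArg _ hp).symm
    _ = adelicFrame F E σ hσδ hδ hd V b
          (((proj F E V Φ ρ (φ₁ (adelicMpContRelabel F (Fin n) (legGL F f e hT) (one_mul_legGL F f e hT) m)) :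
              adelicSp F E V Φ) : AdelicSpace F V ≃ₗ[AdeleRing (𝓞 F) F] AdelicSpace F V)
            (darbouxFrame F E σ hσδ hδ hd V b f e hT (relabelVec F (Fin n) (legGL F f e hT) p))) :=
        frameConj_apply_adelicFrame F E σ hσδ hδ hd V b _ _
    _ = adelicFrame F E σ hσδ hδ hd V b (darbouxFrame F E σ hσδ hδ hd V b f e hT
          (((adelicMpCont.proj F (Fin n) (1 : Matrix (Fin n) (Fin n) (AdeleRing (𝓞 F) F))
              (adelicMpContRelabel F (Fin n) (legGL F f e hT) (one_mul_legGL F f e hT) m) :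
              symplecticGroup (polar (adelicForm F (Fin n) (1 : Matrix (Fin n) (Fin n) (AdeleRing (𝓞 F) F))))) :
            ((Fin n → AdeleRing (𝓞 F) F) × (Fin n → AdeleRing (𝓞 F) F)) ≃ₗ[AdeleRing (𝓞 F) F]
              ((Fin n → AdeleRing (𝓞 F) F) × (Fin n → AdeleRing (𝓞 F) F)))
            (relabelVec F (Fin n) (legGL F f e hT) p))) :=
        congrArg _ (hproj₁ _ _)
    _ = adelicFrame F E σ hσδ hδ hd V b (darbouxFrame F E σ hσδ hδ hd V b f e hT
          (relabelVec F (Fin n) (legGL F f e hT)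
            (((adelicMpCont.proj F (Fin n)
                (UnitaryDualPair.adelicGram F e (symplecticGram F d f) (1 : Matrix (Fin 1) (Fin 1) F)) m :
                symplecticGroup (polar (adelicForm F (Fin n)
                  (UnitaryDualPair.adelicGram F e (symplecticGram F d f) (1 : Matrix (Fin 1) (Fin 1) F))))) :
              ((Fin n → AdeleRing (𝓞 F) F) × (Fin n → AdeleRing (𝓞 F) F)) ≃ₗ[AdeleRing (𝓞 F) F]
                ((Fin n → AdeleRing (𝓞 F) F) × (Fin n → AdeleRing (𝓞 F) F))) p))) :=
        congrArg (fun q => adelicFrame F E σ hσδ hδ hd V b (darbouxFrame F E σ hσδ hδ hd V b f e hT q)) h3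
    _ = adelicFrame F E σ hσδ hδ hd V b ((adelicFrame F E σ hσδ hδ hd V b).symm
          (((adelicMpCont.proj F (Fin n)
              (UnitaryDualPair.adelicGram F e (symplecticGram F d f) (1 : Matrix (Fin 1) (Fin 1) F)) m :
              symplecticGroup (polar (adelicForm F (Fin n)
                (UnitaryDualPair.adelicGram F e (symplecticGram F d f) (1 : Matrix (Fin 1) (Fin 1) F))))) :
            ((Fin n → AdeleRing (𝓞 F) F) × (Fin n → AdeleRing (𝓞 F) F)) ≃ₗ[AdeleRing (𝓞 F) F]
              ((Fin n → AdeleRing (𝓞 F) F) × (Fin n → AdeleRing (𝓞 F) F))) p)) :=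
        congrArg _ (darbouxFrame_relabelVec F E σ hσδ hδ hd V b f e hT _)
    _ = _ := LinearEquiv.apply_symm_apply _ _

end Leg

/-! ## §3. The printed proposition from a leg over the Darboux frame -/

section Printed

variable {S : Type} [NormedAddCommGroup S] [InnerProductSpace ℂ S]
variable (ρ : Representation ℂ (AdelicHeisenberg F E V Φ) S)
variable (i : ratSp F E V Φ →* adelicMp F E V Φ ρ) (hi : IsRationalSplitting F E V Φ ρ i)

include hi he in
/-- **[GelbartRogawski1991, Prop. 3.1.1] AS PRINTED from the record at the dual-pair line datum and a leg over the
Darboux frame** (any quadratic `E/F`): for printed data `(V, Φ, ρ, i)`, a `Φ`-orthogonal frame `b` with `Φ(bᵢ, bᵢ) = fᵢ δ`,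
`φ` non-degenerate, the record `(pairLineDatum …).CompatibleSplitting` and a continuous
`φ₁ : Mp_ψ(𝐀ⁿ × 𝐀ⁿ, std)ᶜᵒⁿᵗ →* Mp_𝐀(W)` over `darbouxFrame b f e` give clauses (1) and (2) verbatim. [cite: GelbartRogawski1991, §3.1 Prop. 3.1.1 p. 455 L1–2] -/
theorem printed_conclusion_of_darbouxLeg
    (hΦ₁ : ∀ (a : E) (x y : V), Φ (a • x) y = a * Φ x y) (hΦ₂ : ∀ (a : E) (x y : V), Φ x (a • y) = Φ x y * σ a)
    (hb : ∀ i j, i ≠ j → Φ (b i) (b j) = 0) (hf : ∀ i, Φ (b i) (b i) = algebraMap F E (f i) * δ)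
    (hφ : (traceForm F E V Φ).Nondegenerate)
    (hi! : ∀ i' : ratSp F E V Φ →* adelicMp F E V Φ ρ, IsRationalSplitting F E V Φ ρ i' → i' = i)
    (hT : IsUnit (symplecticGram F d f).det)
    (φ₁ : adelicMpCont F (Fin n) (1 : Matrix (Fin n) (Fin n) (AdeleRing (𝓞 F) F)) →* adelicMp F E V Φ ρ)
    (hφ₁ : Continuous φ₁)
    (hproj₁ : ∀ (m₁ : adelicMpCont F (Fin n) (1 : Matrix (Fin n) (Fin n) (AdeleRing (𝓞 F) F)))
        (c : (Fin n → AdeleRing (𝓞 F) F) × (Fin n → AdeleRing (𝓞 F) F)),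
      ((proj F E V Φ ρ (φ₁ m₁) : adelicSp F E V Φ) : AdelicSpace F V ≃ₗ[AdeleRing (𝓞 F) F] AdelicSpace F V)
          (darbouxFrame F E σ hσδ hδ hd V b f e hT c) =
        darbouxFrame F E σ hσδ hδ hd V b f e hT
          (((adelicMpCont.proj F (Fin n) (1 : Matrix (Fin n) (Fin n) (AdeleRing (𝓞 F) F)) m₁ :
              symplecticGroup (polar (adelicForm F (Fin n) (1 : Matrix (Fin n) (Fin n) (AdeleRing (𝓞 F) F))))) :
            ((Fin n → AdeleRing (𝓞 F) F) × (Fin n → AdeleRing (𝓞 F) F)) ≃ₗ[AdeleRing (𝓞 F) F]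
              ((Fin n → AdeleRing (𝓞 F) F) × (Fin n → AdeleRing (𝓞 F) F))) c))
    (h₀ : (pairLineDatum F E σ hσδ hδ hd f e hT).CompatibleSplitting) :
    (∃ s : adelicUnitary F E V Φ →* adelicMp F E V Φ ρ,
        ∀ g : adelicUnitary F E V Φ,
          projEnd F E V Φ ρ (s g) =
            ((g : AdelicSpace F V ≃ₗ[AdeleRing (𝓞 F) F] AdelicSpace F V) :
              AdelicSpace F V →ₗ[AdeleRing (𝓞 F) F] AdelicSpace F V)) ∧
      ∃ s : adelicUnitary F E V Φ →* adelicMp F E V Φ ρ,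
        Continuous s ∧
        (∀ g : adelicUnitary F E V Φ,
          projEnd F E V Φ ρ (s g) =
            ((g : AdelicSpace F V ≃ₗ[AdeleRing (𝓞 F) F] AdelicSpace F V) :
              AdelicSpace F V →ₗ[AdeleRing (𝓞 F) F] AdelicSpace F V)) ∧
        ∀ g : adelicUnitary F E V Φ,
          IsRationalPoint F E V Φ (g : AdelicSpace F V ≃ₗ[AdeleRing (𝓞 F) F] AdelicSpace F V) → s g ∈ i.range :=
  printed_conclusion_of_dualPairLine F E σ hσδ hδ hd V b Φ f e he ρ i hi hΦ₁ hΦ₂ hb hf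
    (frame_ne_zero_of_nondegenerate F E σ V b Φ f hΦ₁ hΦ₂ hb hf hφ) hi! hT (mpLeg F E V Φ f e hT ρ φ₁) (continuous_mpLeg F E V Φ f e hT ρ φ₁ hφ₁)
    (mpLeg_proj F E σ hσδ hδ hd V b Φ f e hT ρ φ₁ hproj₁) h₀

end Printed

end Prop311

end Literature.NumberTheory.GelbartRogawski1991

end
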